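import Mathlib

/-!
# Route `FilamentSkeletonRss` · crux `SelectionBoxRJ` (stmt-NavierStokesRegularity-21220) — the 1-D TORQUE LEMMA:
# a bounded circulation profile forced through the flat weight carries NO accretion multiplier

Lane `ns-filament-19175-p1` (g10).  Helper file `--supports stmt-NavierStokesRegularity-21220 --as helper`; bears on the
whole J selection layer (`SelectionBoxRJ` 21220 / `TransverseReductionRJ` 21221 / asides 19174–19175).

SOURCE OF THE STATEMENT.  F6 verdict memo of the crux-level line `rpi_window_split`
(`Cruxes/SelectionBoxRJ/Lines/rpi_window_split_v6_F6.md`, ns-idea-12 g2, 2026-08-28), §3(d) and V2 (R-T): integrating the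
exact torque budget (TB) of an admissible triple over the flat discs `D_R(s)` of filament `j` gives, for transversally
CONFINED vorticity (wall terms negligible) and circle-averaged axial transport `w̄(s) = w′ s`, the scalar equation
`−C″(s) + w′ s C′(s) = 2πB_j (1 − e^{−R²}) e^{−s²}` for the disc circulation `C = C_R`.  With `q := C′` (bounded as soon
as the vorticity is bounded) this is the 1-D problem
`q′ = w′ s q − B̃ e^{−s²}`, `q` bounded on `ℝ`, `w′ > 0`,
and the memo's claim «⇒ B̃ = 0» (explicitly: `q = e^{w′s²/2}[q(0) − B̃∫₀^s e^{−(1+w′/2)σ²}dσ]` forces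
`q(0) = ±½B̃√(π/(1+w′/2))` at `±∞`).  This file KERNEL-CHECKS that claim and the mechanism behind it, the FLAT WEIGHT
`φ = e^{−w′s²/2}` (memo §1(d): the adjoint null vector of `ℓ = −∂_s² + w′ s ∂_s` is flat across the section and Gaussian
along it), in the following generality:

* `hasDerivAt_weight_mul` / `integral_weight_mul_forcing_eq_zero` — FLAT-WEIGHT SOLVABILITY: if `φ′ = −a φ`,
  `q′ = a q − F`, `q` is bounded and `φ → 0` at `±∞`, then `(φ q)′ = −φ F` and `∫ φ F = 0` (any transport rate `a`, any
  integrable pairing `φ F`): the ONE scalar constraint per filament of memo §3(a), with no sign information at all;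
* `multiplier_eq_zero_of_bounded` — if the forcing is `F = B • g` with a shape `g` whose flat-weight pairing is positive
  (`0 < ∫ φ g`), then `B = 0`;
* `gaussWeight_pos`, `hasDerivAt_gaussWeight`, `tendsto_gaussWeight_atTop/atBot`, `integral_gaussWeight_mul_gauss(_pos)` — the Gaussian weight `φ(s) = exp (−w s²/2)` of the rate `a(s) = w s`, `w > 0`: derivative, decay at
  `±∞`, and the positive pairing `∫ exp(−w s²/2) exp(−s²) ds = √(π/(1 + w/2)) > 0` (Mathlib `integral_gaussian`);
* `torqueMultiplier_eq_zero` — THE TORQUE LEMMA: `0 < w`, `q′(s) = w s q(s) − B e^{−s²}` for all `s`, `q` bounded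
  ⇒ `B = 0`; and `eq_zero_of_bounded_of_hasDerivAt_mul` ⇒ then `q ≡ 0` (a bounded solution of `q′ = w s q` vanishes);
* `abs_torqueMultiplier_le` — the QUANTITATIVE form (memo §3(d), «robust without (A)»): with a remainder `r` in the
  budget, `|B| √(π/(1 + w/2)) ≤ ∫ |e^{−w s²/2} r|` (the multiplier is controlled by the flat-weight pairing of the wall
  terms alone);
* `discCirculation_const_of_torque_budget` — the same read on the circulation profile itself:
  `−C″ + w s C′ = K e^{−s²}` on `ℝ` with `C′` bounded ⇒ `K = 0` and `C` is constant.

HONEST FRAMING.  Pure one-variable real analysis; the identification of `q`, `w`, `B` with the disc-circulation slope,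
the stagnation stretching and the accretion multiplier of a HYPOTHETICAL filament-type rotating Leray profile is the memo's
(TB)/(TF) bookkeeping, not claimed here.  Nothing in this file bears on Navier–Stokes regularity or blow-up; no summit
statement is proved by it.
-/

set_option linter.dupNamespace false

noncomputable section

namespace Summit.NavierStokesRegularity.NavierStokesRegularity.Theorems

open Set Function Filter Real MeasureTheory
open scoped Topology

namespace TorqueBudget

/-! ### Flat-weight solvability: `(φ q)′ = −φ F` and `∫ φ F = 0` -/

/-- Product rule behind the flat weight: if `φ′ = −a φ` and `q′ = a q − F` at `s`, then `(φ q)′(s) = −φ(s) F(s)` — the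
transport terms cancel exactly. [folklore] -/
theorem hasDerivAt_weight_mul {a F q φ : ℝ → ℝ} {s : ℝ}
    (hφ : HasDerivAt φ (-(a s) * φ s) s) (hq : HasDerivAt q (a s * q s - F s) s) :
    HasDerivAt (fun σ => φ σ * q σ) (-(φ s * F s)) s := by
  have h := hφ.mul hq
  have e : -(a s) * φ s * q s + φ s * (a s * q s - F s) = -(φ s * F s) := by ring
  rw [e] at h
  exact h

/-- A bounded function times a weight tending to `0` tends to `0`. [folklore] -/
theorem tendsto_weight_mul_zero {q φ : ℝ → ℝ} {l : Filter ℝ} {C : ℝ} (hC : ∀ s, |q s| ≤ C)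
    (hφ : Tendsto φ l (𝓝 0)) : Tendsto (fun s => φ s * q s) l (𝓝 0) := by
  have hC0 : 0 ≤ C := le_trans (abs_nonneg _) (hC 0)
  have hb : Tendsto (fun s => |φ s| * C) l (𝓝 0) := by
    have := (continuous_abs.tendsto 0).comp hφ
    simpa using this.mul_const C
  refine squeeze_zero_norm (fun s => ?_) hb
  rw [Real.norm_eq_abs, abs_mul]
  exact mul_le_mul_of_nonneg_left (hC s) (abs_nonneg _)

/-- **Flat-weight solvability** (F6 memo §3(a), §1(d)): along a transport rate `a`, if the weight solves the ADJOINT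
equation `φ′ = −a φ` and decays at both ends, and `q` is a BOUNDED solution of `q′ = a q − F`, then the forcing is
orthogonal to the weight: `∫ φ F = 0`.  (For `a(s) = w′ s` the weight is the Gaussian `e^{−w′s²/2}`, flat across the
section — the «one scalar constraint per filament».) [folklore] -/
theorem integral_weight_mul_forcing_eq_zero {a F q φ : ℝ → ℝ}
    (hφ : ∀ s, HasDerivAt φ (-(a s) * φ s) s) (hq : ∀ s, HasDerivAt q (a s * q s - F s) s)
    (hbdd : ∃ C, ∀ s, |q s| ≤ C) (htop : Tendsto φ atTop (𝓝 0)) (hbot : Tendsto φ atBot (𝓝 0))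
    (hint : Integrable (fun s => φ s * F s)) : ∫ s, φ s * F s = 0 := by
  obtain ⟨C, hC⟩ := hbdd
  have hderiv : ∀ s, HasDerivAt (fun σ => φ σ * q σ) (-(φ s * F s)) s :=
    fun s => hasDerivAt_weight_mul (hφ s) (hq s)
  have h := integral_of_hasDerivAt_of_tendsto hderiv hint.neg
    (tendsto_weight_mul_zero hC hbot) (tendsto_weight_mul_zero hC htop)
  rw [integral_neg, sub_self, neg_eq_zero] at h
  exact h

/-- If the forcing has the shape `F = B • g` and the shape pairs POSITIVELY with the weight, `0 < ∫ φ g`, then a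
bounded solution exists only for the zero multiplier: `B = 0`. [folklore] -/
theorem multiplier_eq_zero_of_bounded {a g q φ : ℝ → ℝ} {B : ℝ}
    (hφ : ∀ s, HasDerivAt φ (-(a s) * φ s) s) (hq : ∀ s, HasDerivAt q (a s * q s - B * g s) s)
    (hbdd : ∃ C, ∀ s, |q s| ≤ C) (htop : Tendsto φ atTop (𝓝 0)) (hbot : Tendsto φ atBot (𝓝 0))
    (hint : Integrable (fun s => φ s * g s)) (hpos : 0 < ∫ s, φ s * g s) : B = 0 := by
  have hint' : Integrable (fun s => φ s * (B * g s)) := by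
    have := hint.const_mul B
    refine this.congr (Eventually.of_forall fun s => ?_)
    ring
  have h := integral_weight_mul_forcing_eq_zero hφ hq hbdd htop hbot hint'
  have e : (∫ s, φ s * (B * g s)) = B * ∫ s, φ s * g s := by
    rw [← integral_const_mul]
    congr 1; funext s; ring
  rw [e] at h
  rcases mul_eq_zero.mp h with hB | hI
  · exact hB
  · exact absurd hI hpos.ne'

/-- With NO forcing, a bounded solution of `q′ = a q` vanishes identically as soon as the adjoint weight is positive and
decays at `+∞`: `φ q` is constant (derivative `0`) and tends to `0`. [folklore] -/
theorem eq_zero_of_bounded_of_hasDerivAt_mul {a q φ : ℝ → ℝ}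
    (hφ : ∀ s, HasDerivAt φ (-(a s) * φ s) s) (hφpos : ∀ s, 0 < φ s) (hq : ∀ s, HasDerivAt q (a s * q s) s)
    (hbdd : ∃ C, ∀ s, |q s| ≤ C) (htop : Tendsto φ atTop (𝓝 0)) : ∀ s, q s = 0 := by
  obtain ⟨C, hC⟩ := hbdd
  have hderiv : ∀ s, HasDerivAt (fun σ => φ σ * q σ) 0 s := by
    intro s
    have hq' : HasDerivAt q (a s * q s - 0) s := by simpa using hq s
    simpa using hasDerivAt_weight_mul (F := fun _ => 0) (hφ s) hq'
  have hdiff : Differentiable ℝ (fun σ => φ σ * q σ) := fun s => (hderiv s).differentiableAt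
  have hconst : ∀ s t, φ s * q s = φ t * q t :=
    is_const_of_deriv_eq_zero hdiff (fun s => (hderiv s).deriv)
  have hlim : Tendsto (fun s => φ s * q s) atTop (𝓝 0) := tendsto_weight_mul_zero hC htop
  intro s
  have hcst : Tendsto (fun _ : ℝ => φ s * q s) atTop (𝓝 0) :=
    hlim.congr (fun t => hconst t s)
  have h0 : φ s * q s = 0 := tendsto_nhds_unique tendsto_const_nhds hcst
  rcases mul_eq_zero.mp h0 with h | h
  · exact absurd h (hφpos s).ne'
  · exact h

/-! ### The Gaussian weight of the rate `a(s) = w s` -/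

/-! Throughout, the flat weight along the filament is written out as `exp (-(w * s ^ 2 / 2))` (no new definition). -/

/-- `exp (-(w * s ^ 2 / 2)) > 0`. [folklore] -/
theorem gaussWeight_pos (w s : ℝ) : 0 < exp (-(w * s ^ 2 / 2)) := exp_pos _

/-- Adjoint equation: `(e^{−w s²/2})′ = −(w s) e^{−w s²/2}`. [folklore] -/
theorem hasDerivAt_gaussWeight (w s : ℝ) :
    HasDerivAt (fun σ => exp (-(w * σ ^ 2 / 2))) (-(w * s) * exp (-(w * s ^ 2 / 2))) s := by
  have h1 : HasDerivAt (fun σ : ℝ => -(w * σ ^ 2 / 2)) (-(w * s)) s := by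
    have := ((hasDerivAt_pow 2 s).const_mul w).div_const 2
    have e : w * ((2 : ℕ) * s ^ (2 - 1)) / 2 = w * s := by norm_num; ring
    rw [e] at this
    exact this.neg
  have h2 := h1.exp
  have e2 : exp (-(w * s ^ 2 / 2)) * -(w * s) = -(w * s) * exp (-(w * s ^ 2 / 2)) := by
    ring
  rw [e2] at h2
  exact h2

/-- For `w > 0` the weight decays at `+∞`. [folklore] -/
theorem tendsto_gaussWeight_atTop {w : ℝ} (hw : 0 < w) : Tendsto (fun s => exp (-(w * s ^ 2 / 2))) atTop (𝓝 0) := by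
  have h1 : Tendsto (fun s : ℝ => w * s ^ 2 / 2) atTop atTop := by
    have := (tendsto_pow_atTop (α := ℝ) two_ne_zero).const_mul_atTop hw
    exact this.atTop_div_const (by norm_num : (0:ℝ) < 2)
  exact tendsto_exp_neg_atTop_nhds_zero.comp h1

/-- For `w > 0` the weight decays at `−∞` (it is even). [folklore] -/
theorem tendsto_gaussWeight_atBot {w : ℝ} (hw : 0 < w) : Tendsto (fun s => exp (-(w * s ^ 2 / 2))) atBot (𝓝 0) := by
  have h := (tendsto_gaussWeight_atTop hw).comp tendsto_neg_atBot_atTop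
  refine h.congr (fun s => ?_)
  simp [Function.comp]

/-- The flat-weight pairing of the Gaussian forcing shape is an explicit POSITIVE Gaussian integral:
`∫ e^{−w s²/2} e^{−s²} ds = √(π/(1 + w/2))`. [folklore] -/
theorem integral_gaussWeight_mul_gauss (w : ℝ) :
    ∫ s, exp (-(w * s ^ 2 / 2)) * exp (-(s ^ 2)) = Real.sqrt (Real.pi / (1 + w / 2)) := by
  have e : (fun s => exp (-(w * s ^ 2 / 2)) * exp (-(s ^ 2))) = fun s => exp (-(1 + w / 2) * s ^ 2) := by
    funext s
    rw [← exp_add]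
    congr 1; ring
  rw [e]
  exact integral_gaussian (1 + w / 2)

/-- Integrability of that pairing for `w > 0` (indeed for `1 + w/2 > 0`). [folklore] -/
theorem integrable_gaussWeight_mul_gauss {w : ℝ} (hw : 0 < w) :
    Integrable (fun s => exp (-(w * s ^ 2 / 2)) * exp (-(s ^ 2))) := by
  have e : (fun s => exp (-(w * s ^ 2 / 2)) * exp (-(s ^ 2))) = fun s => exp (-(1 + w / 2) * s ^ 2) := by
    funext s
    rw [← exp_add]
    congr 1; ring
  rw [e]
  exact integrable_exp_neg_mul_sq (by linarith)

/-- Positivity of the pairing for `w > 0`. [folklore] -/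
theorem integral_gaussWeight_mul_gauss_pos {w : ℝ} (hw : 0 < w) :
    0 < ∫ s, exp (-(w * s ^ 2 / 2)) * exp (-(s ^ 2)) := by
  rw [integral_gaussWeight_mul_gauss]
  exact Real.sqrt_pos.mpr (div_pos pi_pos (by linarith))

/-! ### The torque lemma -/

/-- **THE 1-D TORQUE LEMMA** (F6 memo §3(d)/V2, «confined admissible ⇒ B = 0», algebraic core).  Let `w > 0` and let
`q : ℝ → ℝ` be differentiable with `q′(s) = w s q(s) − B e^{−s²}` for every `s`.  If `q` is bounded on `ℝ`, then `B = 0`.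
Proof: the Gaussian weight `φ = e^{−w s²/2}` solves the adjoint equation, `(φ q)′ = −B φ e^{−s²}`, `φ q → 0` at both ends,
so `B ∫ e^{−(1+w/2)s²} ds = 0` with a positive Gaussian integral. [folklore] -/
theorem torqueMultiplier_eq_zero {w B : ℝ} {q : ℝ → ℝ} (hw : 0 < w)
    (hq : ∀ s, HasDerivAt q (w * s * q s - B * exp (-(s ^ 2))) s) (hbdd : ∃ C, ∀ s, |q s| ≤ C) : B = 0 :=
  multiplier_eq_zero_of_bounded (a := fun s => w * s) (g := fun s => exp (-(s ^ 2))) (φ := fun s => exp (-(w * s ^ 2 / 2)))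
    (hasDerivAt_gaussWeight w) hq hbdd (tendsto_gaussWeight_atTop hw) (tendsto_gaussWeight_atBot hw)
    (integrable_gaussWeight_mul_gauss hw) (integral_gaussWeight_mul_gauss_pos hw)

/-- … and then the bounded solution itself vanishes: `q ≡ 0` (no circulation variation along the filament without a
multiplier). [folklore] -/
theorem torque_solution_eq_zero {w B : ℝ} {q : ℝ → ℝ} (hw : 0 < w)
    (hq : ∀ s, HasDerivAt q (w * s * q s - B * exp (-(s ^ 2))) s) (hbdd : ∃ C, ∀ s, |q s| ≤ C) : ∀ s, q s = 0 := by
  have hB : B = 0 := torqueMultiplier_eq_zero hw hq hbdd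
  have hq' : ∀ s, HasDerivAt q ((w * s) * q s) s := by
    intro s; simpa [hB] using hq s
  exact eq_zero_of_bounded_of_hasDerivAt_mul (a := fun s => w * s) (hasDerivAt_gaussWeight w) (gaussWeight_pos w) hq'
    hbdd (tendsto_gaussWeight_atTop hw)

/-- The dichotomy read contrapositively: a NON-ZERO multiplier forces every solution of `q′ = w s q − B e^{−s²}` to be
unbounded on `ℝ` (it grows like `e^{w s²/2}` at one end at least). [folklore] -/
theorem unbounded_of_torqueMultiplier_ne_zero {w B : ℝ} {q : ℝ → ℝ} (hw : 0 < w) (hB : B ≠ 0)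
    (hq : ∀ s, HasDerivAt q (w * s * q s - B * exp (-(s ^ 2))) s) : ∀ C, ∃ s, C < |q s| := by
  intro C
  by_contra h
  push Not at h
  exact hB (torqueMultiplier_eq_zero hw hq ⟨C, h⟩)

/-- **Quantitative torque lemma** (F6 memo §3(d), «what is robust without (A)»: `|B_j|·(positive Gaussian constant) ≤
∫ |wall terms| ds`).  If the budget carries a REMAINDER, `q′(s) = w s q(s) − B e^{−s²} + r(s)` with `q` bounded and the
weighted remainder `e^{−w s²/2} r` integrable, then `|B| · √(π/(1 + w/2)) ≤ ∫ |e^{−w s²/2} r(s)| ds`: the multiplier is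
controlled by the flat-weight pairing of the remainder alone. [folklore] -/
theorem abs_torqueMultiplier_le {w B : ℝ} {q r : ℝ → ℝ} (hw : 0 < w)
    (hq : ∀ s, HasDerivAt q (w * s * q s - B * exp (-(s ^ 2)) + r s) s) (hbdd : ∃ C, ∀ s, |q s| ≤ C)
    (hr : Integrable (fun s => exp (-(w * s ^ 2 / 2)) * r s)) :
    |B| * Real.sqrt (Real.pi / (1 + w / 2)) ≤ ∫ s, |exp (-(w * s ^ 2 / 2)) * r s| := by
  -- the forcing is `F = B e^{−s²} − r`
  have hq' : ∀ s, HasDerivAt q ((w * s) * q s - (B * exp (-(s ^ 2)) - r s)) s := by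
    intro s
    have e : w * s * q s - B * exp (-(s ^ 2)) + r s = (w * s) * q s - (B * exp (-(s ^ 2)) - r s) := by ring
    rw [← e]; exact hq s
  have hintg : Integrable (fun s => exp (-(w * s ^ 2 / 2)) * (B * exp (-(s ^ 2)))) := by
    refine ((integrable_gaussWeight_mul_gauss hw).const_mul B).congr (Eventually.of_forall fun s => ?_)
    ring
  have hint : Integrable (fun s => exp (-(w * s ^ 2 / 2)) * (B * exp (-(s ^ 2)) - r s)) := by
    refine (hintg.sub hr).congr (Eventually.of_forall fun s => ?_)
    simp only [Pi.sub_apply]; ring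
  have h0 := integral_weight_mul_forcing_eq_zero (a := fun s => w * s) (φ := fun s => exp (-(w * s ^ 2 / 2)))
    (hasDerivAt_gaussWeight w) hq' hbdd (tendsto_gaussWeight_atTop hw) (tendsto_gaussWeight_atBot hw) hint
  -- split the integral: `B · √(π/(1+w/2)) = ∫ φ r`
  have hsplit : (∫ s, exp (-(w * s ^ 2 / 2)) * (B * exp (-(s ^ 2)) - r s))
      = B * Real.sqrt (Real.pi / (1 + w / 2)) - ∫ s, exp (-(w * s ^ 2 / 2)) * r s := by
    have e1 : (fun s => exp (-(w * s ^ 2 / 2)) * (B * exp (-(s ^ 2)) - r s))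
        = fun s => exp (-(w * s ^ 2 / 2)) * (B * exp (-(s ^ 2))) - exp (-(w * s ^ 2 / 2)) * r s := by
      funext s; ring
    rw [e1, integral_sub hintg hr]
    congr 1
    rw [← integral_gaussWeight_mul_gauss w, ← integral_const_mul]
    congr 1; funext s; ring
  rw [hsplit, sub_eq_zero] at h0
  calc |B| * Real.sqrt (Real.pi / (1 + w / 2))
      = |B * Real.sqrt (Real.pi / (1 + w / 2))| := by
        rw [abs_mul, abs_of_nonneg (Real.sqrt_nonneg _)]
    _ = |∫ s, exp (-(w * s ^ 2 / 2)) * r s| := by rw [h0]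
    _ ≤ ∫ s, |exp (-(w * s ^ 2 / 2)) * r s| := by
        have := norm_integral_le_integral_norm (fun s => exp (-(w * s ^ 2 / 2)) * r s) (μ := volume)
        simpa only [Real.norm_eq_abs] using this

/-- **The torque budget on the circulation profile** (memo (TB) with confined vorticity and `w̄(s) = w s`):
if `−C″ + w s C′ = K e^{−s²}` on `ℝ`, read as `C′ = q`, `q′ = w s q − K e^{−s²}`, with `C′` bounded and `w > 0`, then
the multiplier vanishes, `K = 0`, and the disc circulation is CONSTANT along the filament. [folklore] -/
theorem discCirculation_const_of_torque_budget {w K : ℝ} {C q : ℝ → ℝ} (hw : 0 < w)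
    (hC : ∀ s, HasDerivAt C (q s) s) (hq : ∀ s, HasDerivAt q (w * s * q s - K * exp (-(s ^ 2))) s)
    (hbdd : ∃ M, ∀ s, |q s| ≤ M) : K = 0 ∧ ∀ s t, C s = C t := by
  refine ⟨torqueMultiplier_eq_zero hw hq hbdd, ?_⟩
  have hq0 : ∀ s, q s = 0 := torque_solution_eq_zero hw hq hbdd
  have hdiff : Differentiable ℝ C := fun s => (hC s).differentiableAt
  exact is_const_of_deriv_eq_zero hdiff (fun s => by rw [(hC s).deriv, hq0 s])

/-- In the memo's normalisation the multiplier of filament `j` enters as `K = 2πB(1 − e^{−R²})` for a disc of radius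
`R ≠ 0`; `K = 0` then gives `B = 0`. [folklore] -/
theorem multiplier_eq_zero_of_disc {B R : ℝ} (hR : R ≠ 0) (hK : 2 * Real.pi * B * (1 - exp (-(R ^ 2))) = 0) :
    B = 0 := by
  have h1 : 1 - exp (-(R ^ 2)) ≠ 0 := by
    have hR2 : 0 < R ^ 2 := by positivity
    have : exp (-(R ^ 2)) < 1 := Real.exp_lt_one_iff.mpr (by linarith)
    linarith
  have h2 : (2 * Real.pi) ≠ 0 := by positivity
  have := mul_eq_zero.mp hK
  rcases this with h | h
  · rcases mul_eq_zero.mp h with h' | h'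
    · exact absurd h' h2
    · exact h'
  · exact absurd h h1

end TorqueBudget

end Summit.NavierStokesRegularity.NavierStokesRegularity.Theorems
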